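import Summits.AnomalousDissipation.AnomalousDissipation.Theorems.SolenoidalFractalHomogenisationLagrangianStepCellLawVOddGainDefectSectorialWindow
import Mathlib.LinearAlgebra.Matrix.NonsingularInverse
import HarnessLib

/-!
# K1L `LagrangianRenormalisationStep(Design)` (K1L_D, stmt-AnomalousDissipation-27980; aside 24912), stub `stub_cellLawV0_IS`
# — W5 odd half: THE REAL PART OF THE RESOLVENT PRESERVES THE KATO SECTOR (the algebraic brick of exact sector NON-expansion of `f_T`)
# (helper; `--supports stmt-AnomalousDissipation-27980`; word-independent)

Summits-side helper file of route `SolenoidalFractalHomogenisation` (prover seat `ad-k1l-cellLawV-w1` g2).  The tree's sector-growth theory for the slot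
response `f_T(B)` of a SECTORIAL block is first order (`OddGain.abs_form_qsResp_sub_comm_le`, growth factor `→ (hi/lo)²`).  EXACT non-expansion
would follow from the representation `f_T(B) = (1/π)∫₀^∞ k̂_T(ξ)·Re(B + iξ)⁻¹ dξ` (`k̂_T ≥ 0`: the slot kernel is the AUTOCORRELATION of the trapezoid)
once every `Re(B + iξ)⁻¹` is known to be in the Kato sector `τ` of `B`.  This file PROVES that algebraic brick, in REAL form (no complex numbers):
for real `x` the complex solution `w = p + iq` of `(B + iξ)w = x` is the pair `(p, q)` with `Bp − ξq = x`, `Bq + ξp = 0`, and `xᵀRe(B+iξ)⁻¹z = x·p_z`.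
* `resolvent_pairing_eq` — `x·p_z = p_zᵀBp_x + q_xᵀBq_z` (the `ξ`-terms cancel through the second equations);
* **`resolvent_form_sector`** — if the form of `B` is in the sector `τ` with non-negative diagonal, then
  `(x·p_z − z·p_x)² ≤ τ²·(x·p_x)(z·p_z)` (the `p`- and `q`-channels are each in the sector; `sector_add_aux` adds them);
* `resolvent_form_lower` — `x·p_x ≥ lo(|p_x|² + |q_x|²)` under the window; `resolvent_exists` — for `lo > 0` the real `6 × 6` system is uniquely
  solvable for every `ξ` and `x` (coercive block matrix `[[B, −ξ], [ξ, B]]`, `Matrix.mulVec_injective_iff_isUnit`).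
The Lorentzian Fourier identity for matrix semigroups that would turn this into `OddSectorial`-non-expansion of `excQS` is NOT in the tree (XL).
Everything PROVED, no definition, no named fact, no sorry.  Infrastructure for route-1's rung leaf F-D1.A0 (frontier FORMAL rung); NOT a proof of the
stub, of the crux, of Onsager's conjecture or of anomalous dissipation.  Prover seat `ad-k1l-cellLawV-w1` g2, 2026-08-28.
-/

set_option linter.dupNamespace false

noncomputable section

namespace Summit.AnomalousDissipation.AnomalousDissipation.Theorems.SolenoidalFractalHomogenisation.LagrangianStep.OddGain

open Matrix Finset

/-! ## §10 The real resolvent system `Bp − ξq = x`, `Bq + ξp = 0` -/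

section Resolvent

/-- **The resolvent pairing through the two channels**: if `Bp_x − ξq_x = x` and `Bq_z + ξp_z = 0` then `x·p_z = p_zᵀBp_x + q_xᵀBq_z`
(the `ξ`-cross terms cancel). [folklore] -/
theorem resolvent_pairing_eq {B : Matrix (Fin 3) (Fin 3) ℝ} {ξ : ℝ} {x p_x q_x p_z q_z : Fin 3 → ℝ}
    (hx1 : B *ᵥ p_x - ξ • q_x = x) (hz2 : B *ᵥ q_z + ξ • p_z = 0) :
    x ⬝ᵥ p_z = p_z ⬝ᵥ B *ᵥ p_x + q_x ⬝ᵥ B *ᵥ q_z := by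
  have h2 : ξ • p_z = -(B *ᵥ q_z) := eq_neg_of_add_eq_zero_right hz2
  have hcross : (ξ • q_x) ⬝ᵥ p_z = -(q_x ⬝ᵥ B *ᵥ q_z) := by
    have e : (ξ • q_x) ⬝ᵥ p_z = q_x ⬝ᵥ (ξ • p_z) := by rw [smul_dotProduct, dotProduct_smul]
    rw [e, h2, dotProduct_neg]
  rw [← hx1, sub_dotProduct, hcross, dotProduct_comm (B *ᵥ p_x) p_z]
  ring

/-- **THE REAL PART OF THE RESOLVENT IS IN THE KATO SECTOR OF THE BLOCK.**  Let the form of `B` have non-negative diagonal and lie in the sector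
`τ` (`(aᵀBb − bᵀBa)² ≤ τ²·aᵀBa·bᵀBb`).  If `(p_x, q_x)` and `(p_z, q_z)` solve the real resolvent systems `Bp − ξq = x, Bq + ξp = 0` resp. `… = z`,
then `(x·p_z − z·p_x)² ≤ τ²·(x·p_x)·(z·p_z)` — i.e. `xᵀRe(B+iξ)⁻¹z` is in the sector `τ`, for EVERY real `ξ`. [folklore; Kato, Perturbation Theory V §3.10] -/
theorem resolvent_form_sector {B : Matrix (Fin 3) (Fin 3) ℝ} {τ ξ : ℝ} (hpsd : ∀ a : Fin 3 → ℝ, 0 ≤ a ⬝ᵥ B *ᵥ a)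
    (hsec : ∀ a b : Fin 3 → ℝ, (a ⬝ᵥ B *ᵥ b - b ⬝ᵥ B *ᵥ a) ^ 2 ≤ τ ^ 2 * ((a ⬝ᵥ B *ᵥ a) * (b ⬝ᵥ B *ᵥ b)))
    {x z p_x q_x p_z q_z : Fin 3 → ℝ}
    (hx1 : B *ᵥ p_x - ξ • q_x = x) (hx2 : B *ᵥ q_x + ξ • p_x = 0) (hz1 : B *ᵥ p_z - ξ • q_z = z) (hz2 : B *ᵥ q_z + ξ • p_z = 0) :
    (x ⬝ᵥ p_z - z ⬝ᵥ p_x) ^ 2 ≤ τ ^ 2 * ((x ⬝ᵥ p_x) * (z ⬝ᵥ p_z)) := by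
  rw [resolvent_pairing_eq hx1 hz2, resolvent_pairing_eq hz1 hx2, resolvent_pairing_eq hx1 hx2, resolvent_pairing_eq hz1 hz2]
  have e : p_z ⬝ᵥ B *ᵥ p_x + q_x ⬝ᵥ B *ᵥ q_z - (p_x ⬝ᵥ B *ᵥ p_z + q_z ⬝ᵥ B *ᵥ q_x) =
      (p_z ⬝ᵥ B *ᵥ p_x - p_x ⬝ᵥ B *ᵥ p_z) + (q_x ⬝ᵥ B *ᵥ q_z - q_z ⬝ᵥ B *ᵥ q_x) := by ring
  rw [e]
  have h₁ : (p_z ⬝ᵥ B *ᵥ p_x - p_x ⬝ᵥ B *ᵥ p_z) ^ 2 ≤ τ ^ 2 * ((p_x ⬝ᵥ B *ᵥ p_x) * (p_z ⬝ᵥ B *ᵥ p_z)) := by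
    have h := hsec p_x p_z
    rwa [show (p_x ⬝ᵥ B *ᵥ p_z - p_z ⬝ᵥ B *ᵥ p_x) ^ 2 = (p_z ⬝ᵥ B *ᵥ p_x - p_x ⬝ᵥ B *ᵥ p_z) ^ 2 by ring] at h
  have h₂ : (q_x ⬝ᵥ B *ᵥ q_z - q_z ⬝ᵥ B *ᵥ q_x) ^ 2 ≤ τ ^ 2 * ((q_x ⬝ᵥ B *ᵥ q_x) * (q_z ⬝ᵥ B *ᵥ q_z)) := hsec q_x q_z
  have h := sector_add_aux (hpsd p_x) (hpsd p_z) (hpsd q_x) (hpsd q_z) h₁ h₂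
  calc _ ≤ τ ^ 2 * ((p_x ⬝ᵥ B *ᵥ p_x + q_x ⬝ᵥ B *ᵥ q_x) * (p_z ⬝ᵥ B *ᵥ p_z + q_z ⬝ᵥ B *ᵥ q_z)) := h
    _ = _ := by ring

/-- The diagonal of the resolvent form controls the solution pair: `x·p_x = p_xᵀBp_x + q_xᵀBq_x ≥ lo(|p_x|² + |q_x|²)` under the lower window.
[folklore] -/
theorem resolvent_form_lower {B : Matrix (Fin 3) (Fin 3) ℝ} {ξ lo : ℝ} (hwin : ∀ a : Fin 3 → ℝ, lo * (a ⬝ᵥ a) ≤ a ⬝ᵥ B *ᵥ a)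
    {x p_x q_x : Fin 3 → ℝ} (hx1 : B *ᵥ p_x - ξ • q_x = x) (hx2 : B *ᵥ q_x + ξ • p_x = 0) :
    lo * (p_x ⬝ᵥ p_x + q_x ⬝ᵥ q_x) ≤ x ⬝ᵥ p_x := by
  rw [resolvent_pairing_eq hx1 hx2, mul_add]
  exact add_le_add (hwin p_x) (hwin q_x)

/-- **Existence for the real resolvent system** (`lo > 0`): for every `ξ` and `x` there are `p, q` with `Bp − ξq = x`, `Bq + ξp = 0` — the block
matrix `[[B, −ξ𝟙], [ξ𝟙, B]]` is coercive (`(p;q)ᵀM(p;q) = pᵀBp + qᵀBq ≥ lo(|p|² + |q|²)`), hence injective, hence onto. [folklore] -/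
theorem resolvent_exists {B : Matrix (Fin 3) (Fin 3) ℝ} {lo : ℝ} (hlo : 0 < lo) (hwin : ∀ a : Fin 3 → ℝ, lo * (a ⬝ᵥ a) ≤ a ⬝ᵥ B *ᵥ a)
    (ξ : ℝ) (x : Fin 3 → ℝ) :
    ∃ p q : Fin 3 → ℝ, B *ᵥ p - ξ • q = x ∧ B *ᵥ q + ξ • p = 0 := by
  set M : Matrix (Fin 3 ⊕ Fin 3) (Fin 3 ⊕ Fin 3) ℝ := Matrix.fromBlocks B (-(ξ • (1 : Matrix (Fin 3) (Fin 3) ℝ))) (ξ • 1) B with hM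
  have hMv : ∀ v : Fin 3 ⊕ Fin 3 → ℝ, M *ᵥ v = Sum.elim (B *ᵥ (v ∘ Sum.inl) - ξ • (v ∘ Sum.inr)) (B *ᵥ (v ∘ Sum.inr) + ξ • (v ∘ Sum.inl)) := by
    intro v
    rw [hM, Matrix.fromBlocks_mulVec, Matrix.neg_mulVec, Matrix.smul_mulVec, Matrix.smul_mulVec, Matrix.one_mulVec, Matrix.one_mulVec]
    congr 1
    exact add_comm _ _
  have hinj : Function.Injective M.mulVec := by
    intro v w hvw
    have h0 : M *ᵥ (v - w) = 0 := by rw [Matrix.mulVec_sub, hvw, sub_self]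
    set u := v - w with hu
    set p := u ∘ Sum.inl with hp
    set q := u ∘ Sum.inr with hq
    rw [hMv u] at h0
    have h1 : B *ᵥ p - ξ • q = 0 := by have := congrArg (fun f => f ∘ Sum.inl) h0; simpa using this
    have h2 : B *ᵥ q + ξ • p = 0 := by have := congrArg (fun f => f ∘ Sum.inr) h0; simpa using this
    have hen : p ⬝ᵥ B *ᵥ p + q ⬝ᵥ B *ᵥ q = 0 := by
      have e1 : p ⬝ᵥ (B *ᵥ p - ξ • q) = 0 := by rw [h1, dotProduct_zero]
      have e2 : q ⬝ᵥ (B *ᵥ q + ξ • p) = 0 := by rw [h2, dotProduct_zero]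
      rw [dotProduct_sub, dotProduct_smul, smul_eq_mul] at e1
      rw [dotProduct_add, dotProduct_smul, smul_eq_mul, dotProduct_comm q p] at e2
      linarith
    have hpp : 0 ≤ p ⬝ᵥ p := by rw [self_dotProduct_eq_sum_sq]; exact Finset.sum_nonneg fun i _ => sq_nonneg _
    have hqq : 0 ≤ q ⬝ᵥ q := by rw [self_dotProduct_eq_sum_sq]; exact Finset.sum_nonneg fun i _ => sq_nonneg _
    have hsum : p ⬝ᵥ p + q ⬝ᵥ q = 0 := by
      have := add_le_add (hwin p) (hwin q)
      nlinarith
    have hp0 : p = 0 := dotProduct_self_eq_zero.1 (by linarith)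
    have hq0 : q = 0 := dotProduct_self_eq_zero.1 (by linarith)
    have hu0 : u = 0 := by
      rw [← Sum.elim_comp_inl_inr u]
      show Sum.elim p q = 0
      rw [hp0, hq0]
      ext i; cases i <;> rfl
    exact sub_eq_zero.1 hu0
  have hsurj : Function.Surjective M.mulVec :=
    Matrix.mulVec_surjective_iff_isUnit.2 (Matrix.mulVec_injective_iff_isUnit.1 hinj)
  obtain ⟨v, hv⟩ := hsurj (Sum.elim x 0)
  refine ⟨v ∘ Sum.inl, v ∘ Sum.inr, ?_, ?_⟩
  · have := congrArg (fun f => f ∘ Sum.inl) hv; rw [hMv] at this; simpa using this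
  · have := congrArg (fun f => f ∘ Sum.inr) hv; rw [hMv] at this; simpa using this

end Resolvent

end Summit.AnomalousDissipation.AnomalousDissipation.Theorems.SolenoidalFractalHomogenisation.LagrangianStep.OddGain

end
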